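import Summits.HubbardSuperconductivity.HubbardSuperconductivity.Theorems.KLProgrammeKLRegimeScaleZeroCovarianceFarL2ImagesBare

/-!
# Route `KLProgramme`, crux K3 — engine-flow child (stmt-HubbardSuperconductivity-20437), stub (C) at `n = 0`, located item #22a «(C)-SCALE0-PT2»,
# the FAR-SITE supplier, LOW shell («(2e)-LOW-SHELL-PLANCHEREL», route of record (R221)) — FROM A PARSEVAL-GAP CERTIFICATE TO THE THREE FAR ROWS,
# THE ω-UNIFORM IMAGES CONSTANT, AND THE CLOSER'S `hlow` ENVELOPE

Cell gate-hubbard-kl, seat p1 g22 (supplier).  The hypothesis `hD` of `…FarL2ImagesBare.l2Far_low_of_farLattice` is a bound on the FAR LATTICE SUM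
`Σ_{z ≠ 0, z ∉ disk} √(z₀²+z₁²)ᵏ·‖a_ω(z)‖²` of the infinite-volume kernel.  A kit certificate in the (R221)(3) format encloses, per low-shell frequency `ω`,
the Parseval TOTALS from above and the NEAR sums over the full box `{0} ∪ disk` from below; this file turns the resulting GAPS into `hD` for the three rows:
* §6 `farLattice_bare_zero_le_of_gap` — `∫_{[0,1)²}‖g_ω‖² − Σ_{z ∈ {0} ∪ disk}‖a_ω(z)‖² ≤ D₀ ⇒ hD (k = 0)` (`hasSum_normSq_kernel`, `tsum_far_eq_total_sub_near`);
  `farLattice_bare_two_le_of_gap` — `(2π)⁻²(∫‖∂₀g_ω‖² + ∫‖∂₁g_ω‖²) − Σ_{z ∈ {0} ∪ disk}(z₀²+z₁²)‖a_ω(z)‖² ≤ D₂ ⇒ hD (k = 2)` (`hasSum_sqNorm_mul_normSq_kernel`);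
  `farLattice_bare_one_le_of_gaps` — both gaps `⇒ hD (k = 1)` with `D₁ = √(D₀·D₂)` (`tsum_far_weightOne_le_sqrt`).
Here `g_ω(y) = Ψ¹(ω, e₀(2πy))` (`uvSymbolFn 1 klE0 (frameLevel μ 0 (2π•y)) ω`), `a_ω(z) = 𝓕(g_ω♭)(−z)`, `∂_j g = Dg[e_j]` on the period cell `[0,1)²`, `ω ≠ 0`.
So the cert predicate needs, per `ω`-cell: an UPPER enclosure of `∫|Ψ_ω|²` and of `(2π)⁻²Σ_j∫|∂_jΨ_ω|²`, and LOWER enclosures of the two near box sums —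
precision budget per ref-3 §441/(R221)(3) (absolute per-`ω` gap target) in the cert file's docstring (k3c5 lineage).
* §7 `l2Far_low_of_farLattice_uniform` — the images constant made `ω`-UNIFORM (`m = max(|ω|, klE0/2) ≥ klE0/2` ⇒ `2/m ≤ 4/klE0 = 128`):
  `≤ (√D + √(L^{k+2})·(K!·klChi2CauchyTab K·(K+1)!·(4/klE0)^{K+1}·(8π)ᴷ/π^K)·(4/L)ᴷ·S_K)²`;
  **`l2Far_low_envelope_of_farLattice`** — THE `hlow` OF THE CLOSER `…SunsetCertRowsTwoShells.sunsetRows_of_certV3_twoShells` (k3c5-p1, p646292), literally: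
  if `D k` bounds the row-`k` far lattice sum of the kernel at EVERY Matsubara frequency with `|ω_i| < ω₁` (every row `k : Fin 3`), then
  `∀ k i, |ω_i| < ω₁ → (far ℓ² at ω_i, hΦ shape) ≤ Dlow k` with **`Dlow k := (√(D k) + √(L^{k+2})·C_K^u·(4/L)ᴷ·S_K)²`** (every Matsubara frequency is nonzero);
  the low-shell window sum `Σ_{|ω_i|<ω₁} Dlow ≤ β·ω₁·Dlow` is the closer's own `sum_l2Far_low_le`.

Proofs only; no definitions; nothing here asserts (C), any stub of 20437, K3 or superconductivity.  References: BGM 2006 §3 (3.2)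
[cite: BenfattoGiulianiMastropietro2006]; Grafakos 2014 Prop. 3.2.6 (8), Prop. 3.2.7 (3) [cite: Grafakos2014].
-/

noncomputable section

namespace Summit.HubbardSuperconductivity.HubbardSuperconductivity.Theorems.KLRegimeSplit

set_option linter.dupNamespace false -- summit = problem name (single-conjunct summit), D-0017

open Literature.MathematicalPhysics.QuantumLattice Literature.Probability.LatticeModels Literature.Analysis.FunctionSpaces
open Literature.Analysis.Fourier
open Summit.HubbardSuperconductivity.HubbardSuperconductivity.Theorems.DispersionFlow
open MeasureTheory Finset Complex UnitAddTorus Real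
open scoped Nat

variable {L : ℕ} [NeZero L]

/-! ## §6 From a Parseval-gap certificate to the far lattice sum (the three rows) -/

section Gap

variable (μ : ℝ) {om : ℝ}

/-- The far indicator of the record is the complement of the full box `insert 0 c.disk`. -/
theorem far_iff_not_mem_insert (c : SunsetCellRecordV2) (z : Site 2) : (z ≠ 0 ∧ z ∉ c.disk) ↔ z ∉ insert (0 : Site 2) c.disk := by
  rw [Finset.mem_insert, not_or]

/-- **Row `k = 0` from the gap**: if `∫_{[0,1)²}‖g_ω‖² − Σ_{z ∈ {0} ∪ disk} ‖a_ω(z)‖² ≤ D₀` then the far lattice sum of row `0` is `≤ D₀`. -/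
theorem farLattice_bare_zero_le_of_gap (c : SunsetCellRecordV2) (hom : om ≠ 0) {D₀ : ℝ}
    (hgap : (∫ y in Torus.unitCube (Fin 2), ‖(fun y : Momentum => uvSymbolFn 1 klE0 (frameLevel μ 0 ((2 * π) • y)) om) y‖ ^ 2) -
        ∑ z ∈ insert (0 : Site 2) c.disk, ‖mFourierCoeff (Torus.descend (fun y : Momentum => uvSymbolFn 1 klE0 (frameLevel μ 0 ((2 * π) • y)) om)
          (uvSpatialSymbol_isLatticePeriodic 1 klE0 μ 0 om)) (-z)‖ ^ 2 ≤ D₀) :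
    ∑' z : Site 2, (if z ≠ 0 ∧ z ∉ c.disk then Real.sqrt ((((z 0 : ℤ) : ℝ)) ^ 2 + (((z 1 : ℤ) : ℝ)) ^ 2) ^ ((0 : Fin 3) : ℕ) else 0) *
        ‖mFourierCoeff (Torus.descend (fun y : Momentum => uvSymbolFn 1 klE0 (frameLevel μ 0 ((2 * π) • y)) om)
          (uvSpatialSymbol_isLatticePeriodic 1 klE0 μ 0 om)) (-z)‖ ^ 2 ≤ D₀ := by
  classical
  have hper := uvSpatialSymbol_isLatticePeriodic 1 klE0 μ 0 om
  have hs := uvSpatialSymbol_contDiff 1 μ 0 hom (Λ := klE0)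
  have hP := hasSum_normSq_kernel hper hs
  have hsum : Summable fun z : Site 2 => (1 : ℝ) * ‖mFourierCoeff (Torus.descend _ hper) (-z)‖ ^ 2 := by
    simpa only [one_mul] using hP.summable
  have hfar := tsum_far_eq_total_sub_near hper (w := fun _ => (1 : ℝ)) (insert (0 : Site 2) c.disk) hsum
  simp only [one_mul] at hfar
  rw [hP.tsum_eq] at hfar
  refine le_of_eq_of_le ?_ (hfar.le.trans hgap)
  refine tsum_congr fun z => ?_
  simp only [Fin.val_zero, pow_zero]
  by_cases hz : z ≠ 0 ∧ z ∉ c.disk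
  · rw [if_pos hz, if_neg ((far_iff_not_mem_insert c z).1 hz), one_mul]
  · have hz' : z ∈ insert (0 : Site 2) c.disk := by rw [far_iff_not_mem_insert] at hz; exact not_not.1 hz
    rw [if_neg hz, if_pos hz', zero_mul]

/-- **Row `k = 2` from the gap**: if `(2π)⁻²(∫‖∂₀g_ω‖² + ∫‖∂₁g_ω‖²) − Σ_{z ∈ {0} ∪ disk} (z₀²+z₁²)‖a_ω(z)‖² ≤ D₂` then the far lattice sum of row `2` is `≤ D₂`. -/
theorem farLattice_bare_two_le_of_gap (c : SunsetCellRecordV2) (hom : om ≠ 0) {D₂ : ℝ}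
    (hgap : (2 * π) ^ (-(2 : ℤ)) *
        ((∫ y in Torus.unitCube (Fin 2), ‖fderiv ℝ (fun y : Momentum => uvSymbolFn 1 klE0 (frameLevel μ 0 ((2 * π) • y)) om) y (EuclideanSpace.single 0 (1 : ℝ))‖ ^ 2) +
          ∫ y in Torus.unitCube (Fin 2), ‖fderiv ℝ (fun y : Momentum => uvSymbolFn 1 klE0 (frameLevel μ 0 ((2 * π) • y)) om) y (EuclideanSpace.single 1 (1 : ℝ))‖ ^ 2) -
        ∑ z ∈ insert (0 : Site 2) c.disk, ((((z 0 : ℤ) : ℝ)) ^ 2 + (((z 1 : ℤ) : ℝ)) ^ 2) *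
          ‖mFourierCoeff (Torus.descend (fun y : Momentum => uvSymbolFn 1 klE0 (frameLevel μ 0 ((2 * π) • y)) om)
            (uvSpatialSymbol_isLatticePeriodic 1 klE0 μ 0 om)) (-z)‖ ^ 2 ≤ D₂) :
    ∑' z : Site 2, (if z ≠ 0 ∧ z ∉ c.disk then Real.sqrt ((((z 0 : ℤ) : ℝ)) ^ 2 + (((z 1 : ℤ) : ℝ)) ^ 2) ^ ((2 : Fin 3) : ℕ) else 0) *
        ‖mFourierCoeff (Torus.descend (fun y : Momentum => uvSymbolFn 1 klE0 (frameLevel μ 0 ((2 * π) • y)) om)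
          (uvSpatialSymbol_isLatticePeriodic 1 klE0 μ 0 om)) (-z)‖ ^ 2 ≤ D₂ := by
  classical
  have hper := uvSpatialSymbol_isLatticePeriodic 1 klE0 μ 0 om
  have hs := uvSpatialSymbol_contDiff 1 μ 0 hom (Λ := klE0)
  have hP := hasSum_sqNorm_mul_normSq_kernel hper hs
  have hfar := tsum_far_eq_total_sub_near hper (w := fun z : Site 2 => (((z 0 : ℤ) : ℝ)) ^ 2 + (((z 1 : ℤ) : ℝ)) ^ 2)
    (insert (0 : Site 2) c.disk) hP.summable
  rw [hP.tsum_eq] at hfar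
  refine le_of_eq_of_le ?_ (hfar.le.trans hgap)
  refine tsum_congr fun z => ?_
  have h2 : ((2 : Fin 3) : ℕ) = 2 := rfl
  simp only [h2]
  by_cases hz : z ≠ 0 ∧ z ∉ c.disk
  · rw [if_pos hz, if_neg ((far_iff_not_mem_insert c z).1 hz), Real.sq_sqrt (by positivity)]
  · have hz' : z ∈ insert (0 : Site 2) c.disk := by rw [far_iff_not_mem_insert] at hz; exact not_not.1 hz
    rw [if_neg hz, if_pos hz', zero_mul]

/-- **Row `k = 1` from the two gaps**: `D₁ := √(D₀·D₂)` (Cauchy–Schwarz of the two far sums, `tsum_far_weightOne_le_sqrt`). -/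
theorem farLattice_bare_one_le_of_gaps (c : SunsetCellRecordV2) (hom : om ≠ 0) {D₀ D₂ : ℝ}
    (hgap0 : (∫ y in Torus.unitCube (Fin 2), ‖(fun y : Momentum => uvSymbolFn 1 klE0 (frameLevel μ 0 ((2 * π) • y)) om) y‖ ^ 2) -
        ∑ z ∈ insert (0 : Site 2) c.disk, ‖mFourierCoeff (Torus.descend (fun y : Momentum => uvSymbolFn 1 klE0 (frameLevel μ 0 ((2 * π) • y)) om)
          (uvSpatialSymbol_isLatticePeriodic 1 klE0 μ 0 om)) (-z)‖ ^ 2 ≤ D₀)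
    (hgap2 : (2 * π) ^ (-(2 : ℤ)) *
        ((∫ y in Torus.unitCube (Fin 2), ‖fderiv ℝ (fun y : Momentum => uvSymbolFn 1 klE0 (frameLevel μ 0 ((2 * π) • y)) om) y (EuclideanSpace.single 0 (1 : ℝ))‖ ^ 2) +
          ∫ y in Torus.unitCube (Fin 2), ‖fderiv ℝ (fun y : Momentum => uvSymbolFn 1 klE0 (frameLevel μ 0 ((2 * π) • y)) om) y (EuclideanSpace.single 1 (1 : ℝ))‖ ^ 2) -
        ∑ z ∈ insert (0 : Site 2) c.disk, ((((z 0 : ℤ) : ℝ)) ^ 2 + (((z 1 : ℤ) : ℝ)) ^ 2) *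
          ‖mFourierCoeff (Torus.descend (fun y : Momentum => uvSymbolFn 1 klE0 (frameLevel μ 0 ((2 * π) • y)) om)
            (uvSpatialSymbol_isLatticePeriodic 1 klE0 μ 0 om)) (-z)‖ ^ 2 ≤ D₂) :
    ∑' z : Site 2, (if z ≠ 0 ∧ z ∉ c.disk then Real.sqrt ((((z 0 : ℤ) : ℝ)) ^ 2 + (((z 1 : ℤ) : ℝ)) ^ 2) ^ ((1 : Fin 3) : ℕ) else 0) *
        ‖mFourierCoeff (Torus.descend (fun y : Momentum => uvSymbolFn 1 klE0 (frameLevel μ 0 ((2 * π) • y)) om)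
          (uvSpatialSymbol_isLatticePeriodic 1 klE0 μ 0 om)) (-z)‖ ^ 2 ≤ Real.sqrt (D₀ * D₂) := by
  classical
  have hper := uvSpatialSymbol_isLatticePeriodic 1 klE0 μ 0 om
  have hs := uvSpatialSymbol_contDiff 1 μ 0 hom (Λ := klE0)
  set P : Site 2 → ℝ := fun z => if z ≠ 0 ∧ z ∉ c.disk then 1 else 0 with hPdef
  have hP0 : ∀ z, 0 ≤ P z := fun z => by simp only [hPdef]; split_ifs <;> norm_num
  have hP1 : ∀ z, P z ≤ 1 := fun z => by simp only [hPdef]; split_ifs <;> norm_num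
  have h0 := (hasSum_normSq_kernel hper hs).summable
  have h2 := (hasSum_sqNorm_mul_normSq_kernel hper hs).summable
  have hs0 : Summable fun z : Site 2 => P z * ‖mFourierCoeff (Torus.descend _ hper) (-z)‖ ^ 2 :=
    Summable.of_nonneg_of_le (fun z => mul_nonneg (hP0 z) (sq_nonneg _))
      (fun z => by simpa only [one_mul] using mul_le_mul_of_nonneg_right (hP1 z) (sq_nonneg _)) h0
  have hs2 : Summable fun z : Site 2 => P z * ((((z 0 : ℤ) : ℝ)) ^ 2 + (((z 1 : ℤ) : ℝ)) ^ 2) * ‖mFourierCoeff (Torus.descend _ hper) (-z)‖ ^ 2 :=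
    Summable.of_nonneg_of_le (fun z => mul_nonneg (mul_nonneg (hP0 z) (by positivity)) (sq_nonneg _))
      (fun z => by
        rw [mul_assoc]
        simpa only [one_mul] using mul_le_mul_of_nonneg_right (hP1 z) (by positivity)) h2
  -- the two far sums from the gaps (rows 0 and 2 just proved, re-read with the indicator `P`)
  have hD0 : ∑' z : Site 2, P z * ‖mFourierCoeff (Torus.descend _ hper) (-z)‖ ^ 2 ≤ D₀ := by
    refine le_of_eq_of_le (tsum_congr fun z => ?_) (farLattice_bare_zero_le_of_gap μ c hom hgap0)
    simp only [hPdef, Fin.val_zero, pow_zero]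
  have hD2 : ∑' z : Site 2, P z * ((((z 0 : ℤ) : ℝ)) ^ 2 + (((z 1 : ℤ) : ℝ)) ^ 2) * ‖mFourierCoeff (Torus.descend _ hper) (-z)‖ ^ 2 ≤ D₂ := by
    refine le_of_eq_of_le (tsum_congr fun z => ?_) (farLattice_bare_two_le_of_gap μ c hom hgap2)
    have h2' : ((2 : Fin 3) : ℕ) = 2 := rfl
    simp only [hPdef, h2']
    split_ifs
    · rw [Real.sq_sqrt (by positivity), one_mul]
    · simp
  obtain ⟨-, hcs⟩ := tsum_far_weightOne_le_sqrt hper hP0 hs0 hs2 hD0 hD2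
  refine le_of_eq_of_le (tsum_congr fun z => ?_) hcs
  have h1 : ((1 : Fin 3) : ℕ) = 1 := rfl
  simp only [hPdef, h1, pow_one]
  split_ifs
  · rw [one_mul]
  · simp

end Gap

/-! ## §7 The ω-uniform images constant and the low-shell frequency sum -/

section LowShell

variable (μ : ℝ) {om : ℝ}

omit [NeZero L] in
/-- `2/max(|ω|, klE0/2) ≤ 4/klE0` and `max(1, 2/max(|ω|, klE0/2)) ≤ 4/klE0` (`klE0 = 1/32`). -/
theorem two_div_max_le_klE0 (om : ℝ) : 2 / max |om| (klE0 / 2) ≤ 4 / klE0 ∧ max 1 (2 / max |om| (klE0 / 2)) ≤ 4 / klE0 := by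
  have hE0 : (0 : ℝ) < klE0 := by norm_num [klE0]
  have hm : klE0 / 2 ≤ max |om| (klE0 / 2) := le_max_right _ _
  have hmpos : 0 < max |om| (klE0 / 2) := lt_of_lt_of_le (by positivity) hm
  have h1 : 2 / max |om| (klE0 / 2) ≤ 4 / klE0 := by
    rw [div_le_div_iff₀ hmpos hE0]; linarith
  refine ⟨h1, max_le ?_ h1⟩
  rw [le_div_iff₀ hE0]; norm_num [klE0]

omit [NeZero L] in
/-- **The images constant is ω-uniform**: `C_K(ω)/π^K ≤ K!·(klChi2CauchyTab K·(K+1)!·(4/klE0)²·(4/klE0)^{K−1})·(8π)ᴷ/π^K`. -/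
theorem imagesConst_le_uniform (om : ℝ) (K : ℕ) :
    (K ! * (1 * klChi2CauchyTab K * (K + 1)! * (2 / max |om| (klE0 / 2)) ^ 2 * (max 1 (2 / max |om| (klE0 / 2))) ^ (K - 1)) * ((2 * π) * 4) ^ K) /
        Real.pi ^ K ≤
      (K ! * (klChi2CauchyTab K * (K + 1)! * (4 / klE0) ^ 2 * (4 / klE0) ^ (K - 1)) * ((2 * π) * 4) ^ K) / Real.pi ^ K := by
  obtain ⟨h1, h2⟩ := two_div_max_le_klE0 om
  have hT := one_le_klChi2CauchyTab K
  have hE0 : (0 : ℝ) < klE0 := by norm_num [klE0]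
  have hm0 : 0 ≤ 2 / max |om| (klE0 / 2) := by positivity
  have hx0 : 0 ≤ max 1 (2 / max |om| (klE0 / 2)) := by positivity
  rw [one_mul]
  have hπK : 0 < Real.pi ^ K := by positivity
  refine div_le_div_of_nonneg_right ?_ hπK.le
  refine mul_le_mul_of_nonneg_right (mul_le_mul_of_nonneg_left ?_ (by positivity)) (by positivity)
  have ha : (2 / max |om| (klE0 / 2)) ^ 2 ≤ (4 / klE0) ^ 2 := pow_le_pow_left₀ hm0 h1 2
  have hb : (max 1 (2 / max |om| (klE0 / 2))) ^ (K - 1) ≤ (4 / klE0) ^ (K - 1) := pow_le_pow_left₀ hx0 h2 _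
  have hc : 0 ≤ klChi2CauchyTab K * ((K + 1)! : ℝ) := by positivity
  calc klChi2CauchyTab K * (K + 1)! * (2 / max |om| (klE0 / 2)) ^ 2 * (max 1 (2 / max |om| (klE0 / 2))) ^ (K - 1)
      = (klChi2CauchyTab K * (K + 1)!) * ((2 / max |om| (klE0 / 2)) ^ 2 * (max 1 (2 / max |om| (klE0 / 2))) ^ (K - 1)) := by ring
    _ ≤ (klChi2CauchyTab K * (K + 1)!) * ((4 / klE0) ^ 2 * (4 / klE0) ^ (K - 1)) :=
        mul_le_mul_of_nonneg_left (mul_le_mul ha hb (by positivity) (by positivity)) hc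
    _ = _ := by ring

/-- **LOW-SHELL FAR ℓ² FROM THE FAR LATTICE SUM, ω-uniform images constant**: as `l2Far_low_of_farLattice`, with `C_K(ω)` replaced by its `ω`-free majorant. -/
theorem l2Far_low_of_farLattice_uniform (c : SunsetCellRecordV2) (hom : om ≠ 0) (k : Fin 3) {D : ℝ}
    (hD : ∑' z : Site 2, (if z ≠ 0 ∧ z ∉ c.disk then Real.sqrt ((((z 0 : ℤ) : ℝ)) ^ 2 + (((z 1 : ℤ) : ℝ)) ^ 2) ^ (k : ℕ) else 0) *
        ‖mFourierCoeff (Torus.descend (fun y : Momentum => uvSymbolFn 1 klE0 (frameLevel μ 0 ((2 * π) • y)) om)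
          (uvSpatialSymbol_isLatticePeriodic 1 klE0 μ 0 om)) (-z)‖ ^ 2 ≤ D)
    {K : ℕ} (hK : 2 * 2 ≤ K) :
    ∑ u : TorusSite 2 L,
      (if u ≠ 0 ∧ (fun j => (u j).valMinAbs : Site 2) ∉ c.disk then
        Real.sqrt ((((u 0).valMinAbs.natAbs : ℝ)) ^ 2 + (((u 1).valMinAbs.natAbs : ℝ)) ^ 2) ^ (k : ℕ) *
          ‖torusFourierInv (fun kv : TorusSite 2 L =>
            (fun y : Momentum => uvSymbolFn 1 klE0 (frameLevel μ 0 ((2 * π) • y)) om)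
              (WithLp.toLp 2 fun j => ((kv j).val : ℝ) / L)) u‖ ^ 2
        else 0) ≤
      (Real.sqrt D + Real.sqrt ((L : ℝ) ^ ((k : ℕ) + 2)) *
        ((K ! * (klChi2CauchyTab K * (K + 1)! * (4 / klE0) ^ 2 * (4 / klE0) ^ (K - 1)) * ((2 * π) * 4) ^ K) / Real.pi ^ K *
          (4 / (L : ℝ)) ^ K * ∑' n : Site 2, ((1 + ‖n‖) ^ K)⁻¹)) ^ 2 := by
  refine (l2Far_low_of_farLattice (L := L) μ c hom k hD hK).trans ?_
  have hS : 0 ≤ ∑' n : Site 2, ((1 + ‖n‖) ^ K)⁻¹ := tsum_nonneg fun n => by positivity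
  have hT := one_le_klChi2CauchyTab K
  have hL4 : 0 ≤ (4 / (L : ℝ)) ^ K := by positivity
  have hc := imagesConst_le_uniform om K
  have hc0 : 0 ≤ (K ! * (1 * klChi2CauchyTab K * (K + 1)! * (2 / max |om| (klE0 / 2)) ^ 2 * (max 1 (2 / max |om| (klE0 / 2))) ^ (K - 1)) *
      ((2 * π) * 4) ^ K) / Real.pi ^ K := by positivity
  have h1 : Real.sqrt ((L : ℝ) ^ ((k : ℕ) + 2)) *
        ((K ! * (1 * klChi2CauchyTab K * (K + 1)! * (2 / max |om| (klE0 / 2)) ^ 2 * (max 1 (2 / max |om| (klE0 / 2))) ^ (K - 1)) * ((2 * π) * 4) ^ K) /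
          Real.pi ^ K * (4 / (L : ℝ)) ^ K * ∑' n : Site 2, ((1 + ‖n‖) ^ K)⁻¹) ≤
      Real.sqrt ((L : ℝ) ^ ((k : ℕ) + 2)) *
        ((K ! * (klChi2CauchyTab K * (K + 1)! * (4 / klE0) ^ 2 * (4 / klE0) ^ (K - 1)) * ((2 * π) * 4) ^ K) / Real.pi ^ K *
          (4 / (L : ℝ)) ^ K * ∑' n : Site 2, ((1 + ‖n‖) ^ K)⁻¹) := by
    refine mul_le_mul_of_nonneg_left ?_ (Real.sqrt_nonneg _)
    exact mul_le_mul_of_nonneg_right (mul_le_mul_of_nonneg_right hc hL4) hS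
  have h0 : 0 ≤ Real.sqrt D + Real.sqrt ((L : ℝ) ^ ((k : ℕ) + 2)) *
        ((K ! * (1 * klChi2CauchyTab K * (K + 1)! * (2 / max |om| (klE0 / 2)) ^ 2 * (max 1 (2 / max |om| (klE0 / 2))) ^ (K - 1)) * ((2 * π) * 4) ^ K) /
          Real.pi ^ K * (4 / (L : ℝ)) ^ K * ∑' n : Site 2, ((1 + ‖n‖) ^ K)⁻¹) := by positivity
  exact pow_le_pow_left₀ h0 (by linarith) 2

/-- **THE `hlow` OF THE TWO-SHELLS CLOSER FROM THE FAR LATTICE SUMS** (`0 < β`; the shape of the binder `hlow` of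
`…SunsetCertRowsTwoShells.sunsetRows_of_certV3_twoShells`, literally): if for every row `k` ONE number `D k` bounds the row-`k` far lattice sum of the
infinite-volume kernel at EVERY Matsubara frequency `ω_i` of the low shell `|ω_i| < ω₁` (the Plancherel-complement certificate, read through §6), then
`Dlow k := (√(D k) + √(L^{k+2})·C_K^u·(4/L)ᴷ·S_K)²` is a low-shell far-ℓ² envelope. -/
theorem l2Far_low_envelope_of_farLattice {M : ℕ} {β : ℝ} (hβ : 0 < β) (ω₁ : ℝ) (c : SunsetCellRecordV2) {D : Fin 3 → ℝ}
    (hD : ∀ (k : Fin 3) (i : MatsubaraIdx M), |matsubaraFreq β M i| < ω₁ →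
      ∑' z : Site 2, (if z ≠ 0 ∧ z ∉ c.disk then Real.sqrt ((((z 0 : ℤ) : ℝ)) ^ 2 + (((z 1 : ℤ) : ℝ)) ^ 2) ^ (k : ℕ) else 0) *
        ‖mFourierCoeff (Torus.descend (fun y : Momentum => uvSymbolFn 1 klE0 (frameLevel μ 0 ((2 * π) • y)) (matsubaraFreq β M i))
          (uvSpatialSymbol_isLatticePeriodic 1 klE0 μ 0 (matsubaraFreq β M i))) (-z)‖ ^ 2 ≤ D k)
    {K : ℕ} (hK : 2 * 2 ≤ K) :
    ∀ (k : Fin 3) (i : MatsubaraIdx M), |matsubaraFreq β M i| < ω₁ →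
      ∑ u : TorusSite 2 L,
        (if u ≠ 0 ∧ (fun j => (u j).valMinAbs : Site 2) ∉ c.disk then
          Real.sqrt ((((u 0).valMinAbs.natAbs : ℝ)) ^ 2 + (((u 1).valMinAbs.natAbs : ℝ)) ^ 2) ^ (k : ℕ) *
            ‖torusFourierInv (fun kv : TorusSite 2 L =>
              (fun y : Momentum => uvSymbolFn 1 klE0 (frameLevel μ 0 ((2 * π) • y)) (matsubaraFreq β M i))
                (WithLp.toLp 2 fun j => ((kv j).val : ℝ) / L)) u‖ ^ 2
          else 0) ≤
      (Real.sqrt (D k) + Real.sqrt ((L : ℝ) ^ ((k : ℕ) + 2)) *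
        ((K ! * (klChi2CauchyTab K * (K + 1)! * (4 / klE0) ^ 2 * (4 / klE0) ^ (K - 1)) * ((2 * π) * 4) ^ K) / Real.pi ^ K *
          (4 / (L : ℝ)) ^ K * ∑' n : Site 2, ((1 + ‖n‖) ^ K)⁻¹)) ^ 2 :=
  fun k i hi => l2Far_low_of_farLattice_uniform (L := L) μ c (matsubaraFreq_ne_zero' hβ i) k (hD k i hi) hK

end LowShell





end Summit.HubbardSuperconductivity.HubbardSuperconductivity.Theorems.KLRegimeSplit

end
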